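import Literature.Computability.Complexity.GateEliminationCase54Q21
import Literature.Computability.Complexity.GateEliminationCase54Q22
import Literature.Computability.Complexity.GateEliminationCase54Q23XorY
import Literature.Computability.Complexity.GateEliminationCase54Protected
import Literature.Computability.Complexity.GateEliminationCase51
import Literature.Computability.Complexity.GateEliminationCase53

/-!
# Gate elimination: Case 5 of Li–Yang's Theorem 4.1, assembled

The one-step claim in Case 5 of the proof of Li–Yang's Theorem 4.1 (ECCC TR21-023, §4.1):
`LiYang2022_case5_4_holds` (Case 5.4, from the dispatcher `LiYang2022_case5_4_holds_aux` and its
four substitution leaves — the affine leaves of Cases 5.4.1.1.3 and 5.4.2, the protected leaf of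
Case 5.4.1.3, and the quadratic leaf of Case 5.4.1.4 `stepGoal_quadratic`, itself the main line
`stepGoal_quadratic_aux` with the hard sub-cases 5.4.1.4.1.1/3/4, 5.4.1.4.2.1–5), and
`LiYang2022_case5_holds` (Cases 5.1–5.4). Everything PROVED.

## References

* J. Li, T. Yang, *3.1n − o(n) circuit lower bounds for explicit functions*, STOC 2022;
  ECCC TR21-023, §4.1 (Case 5), Lemma 3.11.
-/

namespace Literature.Computability.Complexity

open Finset

namespace Semicircuit

variable {n : ℕ} {C : Semicircuit n} {f : (Fin n → ZMod 2) → Bool} {R : RdqSource n} {d : ℕ}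
  {αφ αI αQ : ℝ} {G : Fin C.m} {x y : Fin n} {B C' D : Fin C.m} {aX aB aC aD : Fin 2}

/-- **Case 5.4.1.4 of the proof of Thm. 4.1** (the quadratic substitution), all sub-cases included.
[cite: LiYang2022, §4.1 (Case 5.4.1.4)] -/
theorem stepGoal_quadratic (hf : IsAffineDisperser f d) (hd : 2 * d + 2 < R.dim) (hF : C.Fair)
    (hC : C.ComputesRestr f R) (hS : C.Standing R) (hcfg : C.Case5Config G x y B C' D aX aB aC aD)
    (hφ0 : 0 < αφ) (hφ : αφ < 1 / 2) (hI0 : 0 < αI) (hQ0 : 0 < αQ) (hBC : B ≠ C') (hnDB : ¬ C.Reads D B)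
    {E : Fin C.m} {aE : Fin 2} {u : Fin n} (hDn : ¬ IsAndOp (C.op D)) (hIu : C.arg D aD.rev = .var u)
    (hup : ¬ R.Protected u) (hu1 : C.fanout (.var u) = 1) (hD2 : C.fanout (.gate D) = 2)
    (hEand : IsAndOp (C.op E)) (hED : C.arg E aE = .gate D) (hE1 : C.fanout (.gate E) = 1)
    (hEo : (∃ t, C.arg E aE.rev = .var t ∧ C.fanout (.var t) = 2) ∨
      (C.arg E aE.rev = .gate B ∧ ¬ IsAndOp (C.op B) ∧ ∃ t, C.arg B aB.rev = .var t ∧ C.fanout (.var t) + C.fanout (.gate B) = 3)) :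
    C.StepGoal f R αφ αI αQ :=
  stepGoal_quadratic_aux hf hd hF hC hS hcfg hφ0 hI0 hnDB hDn hIu hup hu1 hD2 hEand hED hE1 hEo
    (fun _ hEB _ hBt hB1 ht2 => stepGoal_quad11 hf hd hF hC hS hcfg hφ0 hφ hI0 hBC hDn hIu hup hu1 hEand hED hEB hBt hB1 ht2)
    (fun _ _ hBn hBt _ ht1 => stepGoal_quad13 hf hd hF hC hS hcfg hφ0 hφ hI0 hQ0 hBC hup hBn hBt ht1)
    (fun _ _ _ hEt hft hFE hFD hFt =>
      stepGoal_quad21 hf hd hF hC hS hcfg hφ0 hφ hI0 hnDB hDn hIu hup hu1 hD2 hEand hED hEt hft hFE hFD hFt)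
    (fun _ _ _ _ _ _ _ hFD hFu _ hF1 hu'2 _ _ _ hY1 hY2 hY3 hY4 hY5 hY6 =>
      stepGoal_quad22 hf hd hF hC hS hcfg hφ0 hI0 hDn hIu hu1 hEand hFD hFu hF1 hu'2 hY1 hY2 hY3 hY4 hY5 hY6)
    (fun _ F _ _ hEt _ hFE hFD hFu hut hF2 hu' => by
      by_cases hFand : IsAndOp (C.op F)
      · exact stepGoal_quad23_and hf hd hF hC hS hcfg hφ0 hφ hI0 hIu hup hu1 hD2 hEand hED hEt hFE hFD hFu hut hFand
      · rcases hu' with h1 | hy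
        · exact stepGoal_quad23_xor hf hd hF hC hS hcfg hφ0 hφ hI0 hQ0 hDn hIu hup hu1 hD2 hEand hED hEt hFE hFD hFu hut hF2 h1 hFand
        · subst hy
          exact stepGoal_quad23_xor_y hf hd hF hC hS hcfg hφ0 hφ hI0 hnDB hDn hIu hup hu1 hD2 hEand hED hEt hFE hFD hFu hut hFand)

end Semicircuit

/-- **Case 5.4 of the proof of Thm. 4.1.** [cite: LiYang2022, §4.1 (Case 5.4)] -/
theorem LiYang2022_case5_4_holds : LiYang2022_case5_4 := by
  intro αφ αI αQ hφ0 hφ hI hQ n d f hf C R hF hC hd hS G x y B C' D aX aB aC aD hcfg hextra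
  obtain ⟨hBC, hnDB, hnBD⟩ := hextra
  exact Semicircuit.LiYang2022_case5_4_holds_aux hf hd hF hC hS hcfg hφ0 hφ hI αQ hBC hnDB hnBD
    (fun E aE t u h1 h2 h3 h4 h5 h6 h7 h8 h9 h10 =>
      Semicircuit.stepGoal_affine_BD hf hd hF hC hS hcfg hφ0.le hI.le αQ hBC h1 h2 h3 h4 h5 h6 h7 h8 h9 h10)
    (fun E aE t z h1 h2 h3 h4 h5 h6 => Semicircuit.stepGoal_affine_B2 hf hd hF hC hS hcfg hφ0.le hI.le αQ hBC h1 h2 h3 h4 h5 h6)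
    (fun E aE u h1 h2 h3 h4 h5 h6 h7 h8 h9 =>
      Semicircuit.stepGoal_quadratic hf hd hF hC hS hcfg hφ0 hφ hI hQ hBC hnDB h1 h2 h3 h4 h5 h6 h7 h8 h9)
    (fun E aE u h1 h2 h3 h4 h5 h6 h7 h8 h9 =>
      Semicircuit.case5_protected_second hf hd hF hC hS hcfg hφ0 hI hBC hnDB h1 h2 h3 h4 h5 h6 h7 h8 h9)

/-- **The one-step claim in Case 5 of the proof of Thm. 4.1** (Cases 5.1–5.4 of Li–Yang).
[cite: LiYang2022, §4.1 (Case 5)] -/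
theorem LiYang2022_case5_holds : LiYang2022_case5 :=
  Semicircuit.LiYang2022_case5_of_split LiYang2022_case5_1_holds LiYang2022_case5_2_holds LiYang2022_case5_3_holds
    LiYang2022_case5_4_holds

end Literature.Computability.Complexity
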